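import Summits.QuantumFields.BalabanUV.T4Continuum.Support.NE9CurChartOneInstanceSmallField
import Literature.MathematicalPhysics.QuantumFieldTheory.Balaban1983to89.B9Eq3126H1BoundCLM
import Literature.MathematicalPhysics.QuantumFieldTheory.Balaban1983to89.B11Eq118RegimeRadiiUniform
import Literature.MathematicalPhysics.QuantumFieldTheory.Balaban1983to89.B11Eq143LinearTermRadiiUniform
import Literature.MathematicalPhysics.QuantumFieldTheory.Balaban1983to89.B11Eq79LinearTermUniform

/-!
# NE9CurChartOneInstanceUniformBall — THE ONE-INSTANCE CHART OF `cur U` (`W80` in the W-slot at the T-slot's own `(H(U), C(U), ε_C)`, the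
# J-79 term in the linear slot `Λ := −(𝔊(U) ∘L L_J)`) ON ONE AND THE SAME PAIR OF BALLS FOR EVERY SMALL FIELD `U` OF A FIXED LATTICE AND EVERY
# SMALL CURRENT: (A′) `Support/NE9CurChartOneInstanceSmallField.cur_chart_exists_oneInstance_smallField` (T24, this lineage gen 67) with the T-slot
# radii `a_C, ε_C`, the W-slot's (98)-letters `(C₄, a₃)`, the chart radii `ε₄, R_b, R′` and the current threshold `j₁` ALL chosen BEFORE `∀ U`;
# cell `pub-balaban`, T4-DAG §2 node U3 ∕ §6 NE9, route R2′ of `t4/ROUTES-NE9.md`; NE9 crux-team leaf lineage `b2b-balaban-t4-ne9-formalise-leaf-05`,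
# generation 68; Summits-side NEW leaf under this seat's INTERFACE REQUEST NE9 (ruling e34b3e0c (0): «no new leaves unless a CRUX prover requests a
# specific NAMED interface» — requested: `NE9CurChartOneInstanceUniformBall.cur_chart_exists_oneInstance_smallField_uniform` (+ `_W80`, `_smallJ`);
# a separate file because the host leaf (A′) (372 l.) would exceed the 400-line rule — the owner's `NE9CurChartUniformBall` precedent for the END's
# `Λ := 0` face), nothing printed asserted

HONEST FRAMING (T4-DAG PAGE 1).  Rung (B)+1 of the FINITE-VOLUME T⁴ programme — NOT infinite volume, NOT a mass gap, NOT the Clay problem.  NE9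
(`T4OutputRate.NE9` ∧ `FadingMemory`) is a cell NEW ESTIMATE, NOT PRINTED in [I] = [Balaban1987RG1] (CMP **109**), [II] = [Balaban1988RG2Cluster]
(CMP **116**), and NOT PROVED here («NE9 ⇐ the named binders»; spine PROVED 0∕9).  HONEST DEPENDENCY (cell line, verbatim): continuum YM on T⁴ ⇐
BetaPertH ∧ nine spine estimates (0/9 proved); BetaPertH ⇐ (D1) ∧ (D4) ∧ CAP+tail; G-an2-4 gates asym, D1 and NE2/3/4.  The `cur U` OBJECT is ONE
item of the MODEL O-NE9-1 (species (a) data); the END's `act` ∕ `ker` halves and NEEDS-COORDINATOR #5 are untouched.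

WHY (the owner's remark W-ne9p1-g81-1, journal l.39835; the desk's v36 «the optional (A′) v1.x `_uniform` stays cell-only … shrinks (d3)'s «uniform in
U at fixed lattice» sub-clause»).  In (A′) §1 the radii `a_C ε_C ε₄ R_b R′` sit AFTER `∀ U … ∃ hpos` (U-DEPENDENT numbers: `exists_regime_radii` at
`‖H(U)‖`, `exists_regime_radii_linear` at `‖𝔊(U)‖`, the W-slot's `exists_quadAnalytic_W80` with an `isBigO` Taylor remainder of `C(U)`, and (A′) §3's
`j₁(U)` by finite-dimensionality), so the consumers (B′)∕(C′) must re-choose their readings `ιr X (ball 0 (D.R X)) ⊆ ball 0 R_b`, `πr X (ball 0 R′) ⊆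
ball 0 (R₁ X)` for every background.  Uniform bricks now in the tree: the owner's (K) `B9Eq3126H1BoundCLM` (`‖H(U)‖ ≤ C_H′`, `‖𝔊(U)‖ ≤ C_G′` over the
small-field set), NE9 leaf-01's `B11Eq118RegimeRadiiUniform.sectC_regime_uniform_opNorm` (T-slot `(a_C, ε_C) = r_C(C_H′, d)`), this lineage's (D′)
`B11Eq143LinearTermRadiiUniform.regime_linear_explicit` (Λ-slot `(a, ε₄)` at `(C_G′, θ̄, C₄, a₃)`), and — this generation, Cauchy's inequalities on complex
lines — `B11Ineq73KernelLettersUniform.exists_quadAnalytic_W80_uniform` (the W-slot's `(C₄, a₃)` from bounds) and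
`B11Eq79LinearTermUniform.exists_norm_LJ_le_uniform` (`‖L_J‖ ≤ K‖J‖`, `K` U-free), fed at the chain by (N) `norm_nabla115_le` (`M_D = 2|η|⁻¹`) and NE9
leaf-03's U-free `C(U)` constants.

WHAT THIS FILE PROVES (THREE theorems; 0 def, 0 sorry, axioms standard).  §1 **`cur_chart_exists_oneInstance_smallField_uniform`**: `∃ ε₃ C_H C_G a_C ε_C`
(`4C_HC₂(ε_C+a_C) < 1`, `2(ε_C+a_C) ≤ c₄`) such that for ALL displayed letters `C₄ ≥ 0`, `0 < a₃ ≤ a_C`, `0 ≤ θ̄ < 1` there are `ε₄, R_b, R′ > 0` such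
that for EVERY background `U` of E162's data with `‖U(b) − 1‖ ≤ ε ≤ ε₃` and `hRS`, and all `ρ`, `τc`, `J`, `Δπ`: `hpos(U)` HOLDS (PRODUCED by the owner's
(E), [Balaban1985BackgroundPropagators] Thm 3.11) and — at `H(U) := H1LatticeCLM φ hpos …`, `𝔊(U) := frakGLatticeCLM φ hpos …`, `C(U) := Cc …` —
`‖H(U)‖ ≤ C_H`, `‖𝔊(U)‖ ≤ C_G`, `Regime H(U) 0 C(U) C_H 0 C₂ c₄ 0 a_C ε_C`, and WHENEVER `‖W80 … ε_C J Δπ Y‖ ≤ C₄‖Y‖²` on `‖Y‖ < a₃` and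
`‖𝔊(U) ∘L L_J‖ ≤ θ̄`, (Ψ1)–(Ψ3) for `chartHB 𝔊(U) (−(𝔊(U) ∘L L_J)) (W80 ρ τc U H(U) C(U) ε_C J Δπ) 0 (A′ ↦ A′ + solA H(U) 0 C(U) 0 ε_C A′) ε₄ H(U)` on
`ball 0 R_b → ball 0 R′` (`R_b := a∕(C_H + 1)`, `R′ := (ε₄ + a)∕(1 − 4C_HC₂(ε_C + a_C))`; E116 `chartHB_triple_of_twoRegimes`).  §2
**`…_uniform_W80`**: the `C₄` display DISCHARGED — for fixed `ρ`, `τc`, V₀-slot letters `(C_V, R_V)` and current bounds `(M_J, M_Δ)`, the W-slot's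
`(C₄, a₃)` join the `∃` before `∀ U` and `QuadAnalytic (W80 …) C₄ a₃` is a CONCLUSION.  §3 **`…_uniform_smallJ`**: the `θ̄` display DISCHARGED too — a
threshold `0 < j₁ ≤ M_J` joins the `∃`, and for `‖J‖₍₋₃₎ ≤ j₁`, `‖Δπ‖ ≤ M_Δ` the conclusion is `hpos ∧ QuadAnalytic … ∧ ‖𝔊(U) ∘L L_J‖ ≤ ½ ∧ (Ψ1)–(Ψ3)`
with NO uniform letter displayed: T23's species with (d2)'s positivity, its small-J threshold AND (d3)'s radii uniform in `U` at a fixed lattice.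
DISGUISE TEST: composition of landed theorems + real arithmetic; no inequality of the series proved; every number is a per-LATTICE number — NOT print's
uniformity in the LATTICE ([Balaban1985BackgroundPropagators] Thms 3.12∕3.13), NOT (73)∕(97)'s «d and L only», NOT (28) as printed; the Λ-road is ONE of
T23's two admissible placements — the chain's road stays the OWNER's decision; not NE9.
References (TYPES ∕ loci only): [Balaban1985Variational] (28) p. 282, (45)–(47) p. 285, (62) p. 287, (73) p. 289, (79)–(80) p. 290, Prop. 4 (97)–(98)
pp. 292–293, Prop. 6 (117)–(121) p. 295, (143) p. 300, (172)–(175) p. 305; [Balaban1985BackgroundPropagators] (3.26) p. 395, Thm 3.4 p. 400, Thm 3.11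
p. 416, (3.126) p. 420, (3.153) p. 426.
Imports (A′) `Support/NE9CurChartOneInstanceSmallField` (this lineage gen 67), (K) `B9Eq3126H1BoundCLM` (owner gen 81), `B11Eq118RegimeRadiiUniform`
(NE9 leaf-01 gen 74), (D′) `B11Eq143LinearTermRadiiUniform` (gen 67), `B11Eq79LinearTermUniform` (gen 68; it imports `B11Ineq73KernelLettersUniform`)
ONLY; modifies nothing; no END re-wired.  Value = route R2′ bookkeeping at rung (B)+1, NOT summit progress.
-/

noncomputable section

open Metric Set
open scoped InnerProductSpace

namespace Summit.QuantumFields.BalabanUV.T4Continuum.NE9CurChartOneInstanceUniformBall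

open Literature.MathematicalPhysics.QuantumFieldTheory.Balaban1983to89
open B11Eq103H1Complex B11Eq115Space B11Eq174Chart
open B11Eq111FrakG (nabla115)
open B13Contraction113 (QuadAnalytic)
open B11Prop6Scheme (Prop4Hyp)
open B9Eq319QprimeTorus (fineP)
open B9SectCLatticeCarrier (Bond)
open B4Sect5Torus (TSite)
open B7Prop1Explicit (U1 Wcx boxVec)
open B9Eq315QTorus (perCfg cornerSite QtorusW laplaceAofBackground)
open B9Eq315QTorusOnto (QtorusW_surjective)
open B9Eq310HessianOperator (adTransportW)
open B9Thm311SmallFieldClosed (laplaceAofBackground_pos_of_small_field)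
open B9Eq3126H1BoundCLM (exists_H1_frakG_CLM_bound_of_small_field)
open B11Eq118RegimeRadiiUniform (sectC_regime_uniform_opNorm radius_pos radius_contr)
open B11Eq143LinearTermRadiiUniform (regime_linear_explicit min3_pos radiiLinear_add_le)
open B11Eq44COperatorTorus (Cc analyticOnNhd_Cc prop4Hyp_Cc)
open B11Eq80Current (W80 analyticOnNhd_W80_lt)
open B11Eq79LinearTerm (LJ)
open B11Eq63V0GroupCurrent (curV0)
open B9Eq315QTorusOnto (liftSite perSite_liftSite)
open B11Eq117TransformationNorm (norm_nabla115_le)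
open B11Ineq73KernelLettersUniform (exists_quadAnalytic_W80_uniform)
open B11Eq79LinearTermUniform (exists_norm_LJ_le_uniform)
open Summit.QuantumFields.BalabanUV.T4Continuum.NE9B11ChartAnalytic (chartHB_triple_of_twoRegimes)

set_option maxRecDepth 8192 in
/-- **THE ONE-INSTANCE CHART OF `cur U` ON ONE PAIR OF BALLS FOR EVERY SMALL FIELD OF A FIXED LATTICE, MODULO TWO DISPLAYED UNIFORM LETTERS.**
There are `ε₃ > 0` ([Balaban1985BackgroundPropagators] Thm 3.11 threshold of the owner's (E), cut by (K)'s `ε₅`), uniform operator letters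
`C_H, C_G > 0` ((K): `‖H(U)‖ ≤ C_H`, `‖𝔊(U)‖ ≤ C_G` on the small-field set) and T-slot radii `a_C, ε_C > 0` with `4C_HC₂(ε_C + a_C) < 1`,
`2(ε_C + a_C) ≤ c₄` (NE9 leaf-01's closed form `r_C(C_H, d)`) such that for ALL letters `C₄ ≥ 0`, `0 < a₃ ≤ a_C`, `0 ≤ θ̄ < 1` there are `ε₄, R_b, R′ > 0` such that for EVERY
background `U` of E162's data with `‖U(b) − 1‖ ≤ ε ≤ ε₃` and mutually adjoint transporters `hRS`, and all (L3) letters `ρ`, `τc`, `J`, `Δπ`: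
`hpos(U)` HOLDS (`∃ hpos`, PRODUCED) and — with `H(U) := H1LatticeCLM φ hpos …`, `𝔊(U) := frakGLatticeCLM φ hpos …`, `C(U) := Cc …` —
`‖H(U)‖ ≤ C_H ∧ ‖𝔊(U)‖ ≤ C_G ∧ Regime H(U) 0 C(U) C_H 0 C₂ c₄ 0 a_C ε_C` (`C₂ = 2097152(d+1)²`, `c₄ = 1∕(512(d+1))`) and, WHENEVER
`‖W80 ρ τc U H(U) C(U) ε_C J Δπ Y‖ ≤ C₄‖Y‖²` on `‖Y‖ < a₃` (the (98) bound with the displayed constant) and `‖𝔊(U) ∘L L_J‖ ≤ θ̄`, (Ψ1)–(Ψ3) for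
`chartHB 𝔊(U) (−(𝔊(U) ∘L LJ ρ τc H(U) C(U) J)) (W80 ρ τc U H(U) C(U) ε_C J Δπ) 0 (A′ ↦ A′ + solA H(U) 0 C(U) 0 ε_C A′) ε₄ H(U)` on `ball 0 R_b → ball 0 R′`.
Radii: `ε₄ := min (a₃∕4) (min (a_C∕2) ((1 − θ̄)∕(16(C_GC₄ + 1))))`, `a := (1 − θ̄)ε₄∕(4(θ̄ + 1))` ((D′) `regime_linear_explicit`), `R_b := a∕(C_H + 1)`,
`R′ := (ε₄ + a)∕(1 − 4C_HC₂(ε_C + a_C))`; composition by E116 `chartHB_triple_of_twoRegimes`. [folklore] -/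
theorem cur_chart_exists_oneInstance_smallField_uniform {d : ℕ} (L : ℕ) [NeZero L] (m : Fin d → ℕ) [∀ i, NeZero (fineP L m i)]
    (hL : 1 ≤ L)
    {𝔸 : Type*} [NormedRing 𝔸] [NormedAlgebra ℂ 𝔸] [CompleteSpace 𝔸] [NormOneClass 𝔸] [StarRing 𝔸] [NormedStarGroup 𝔸] [StarModule ℂ 𝔸]
    [FiniteDimensional ℂ 𝔸]
    {W : Type*} [NormedAddCommGroup W] [InnerProductSpace ℂ W] [FiniteDimensional ℂ W] (φ : W ≃ₗ[ℂ] 𝔸) {Mφ Mφ' : ℝ} (hMφ : 0 ≤ Mφ)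
    (hMφ' : 0 ≤ Mφ') (hφ : ∀ w, ‖φ w‖ ≤ Mφ * ‖w‖) (hφ' : ∀ X, ‖φ.symm X‖ ≤ Mφ' * ‖X‖)
    (τ : 𝔸 →ₗ[ℂ] ℂ) {Cτ : ℝ} (hτ : ∀ X, ‖τ X‖ ≤ Cτ * ‖X‖) (hCτ : 0 ≤ Cτ)
    {η : ℝ} [Fact (0 < (L : ℝ))] [Fact (0 < η)] {lev₀ : Bond d (fineP L m) → ℕ} {levB : Bond d m → ℕ} (lev₁ : Bond d (fineP L m) × Fin d → ℕ)
    (hlev : ∀ b, 1 ≤ lev₀ b) {c₀ c₁ : ℝ} [Fact (0 < c₀)] [Fact (0 < c₁)] {a : ℝ} (ha : 0 < a) :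
    ∃ ε₃ CH CG aC εC : ℝ, 0 < ε₃ ∧ 0 < CH ∧ 0 < CG ∧ 0 < aC ∧ 0 < εC ∧
      4 * CH * (2097152 * ((d : ℝ) + 1) ^ 2) * (εC + aC) < 1 ∧ 2 * (εC + aC) ≤ 1 / (512 * ((d : ℝ) + 1)) ∧
      ∀ {C₄ a₃ θ : ℝ}, 0 ≤ C₄ → 0 < a₃ → a₃ ≤ aC → 0 ≤ θ → θ < 1 →
      ∃ ε₄ Rb R' : ℝ, 0 < ε₄ ∧ 0 < Rb ∧ 0 < R' ∧
      ∀ (U : Bond d (fineP L m) → 𝔸ˣ) {α : ℝ} (hα : α ≤ 1 / 128) (hα1 : α ≤ 1 / 64)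
        (hU1 : ∀ (x : B7Prop1Explicit.Site d) (κ : Fin d), perCfg (fineP L m) U x κ ∈ U1 𝔸)
        (hreg : ∀ (y : TSite d m) (κ : Fin d) (r : Fin d → Fin L),
          ‖((Wcx L (perCfg (fineP L m) U) (cornerSite L y) κ (boxVec L r) : 𝔸ˣ) : 𝔸) - 1‖ ≤ α)
        (hαL : 50 * (d + 1) * α * (L : ℝ) ^ d ≤ 1 / 2) {ε : ℝ}, 0 ≤ ε → ε ≤ ε₃ → (∀ b, ‖(U b : 𝔸) - 1‖ ≤ ε) →
        (∀ (b : Bond d (fineP L m)) (v u : W), inner ℂ (adTransportW φ U b v) u = inner ℂ v (adTransportW φ (fun b => (U b)⁻¹) b u)) →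
      ∀ (ρ : (𝔸 →L[ℂ] ℂ) →L[ℂ] 𝔸) (τc : 𝔸 →L[ℂ] ℂ)
        (J : NegSize (L : ℝ) η lev₀ 3 𝔸) (Δπ : Space115 (L : ℝ) η lev₀ lev₁ (nabla115 η U) →L[ℂ] NegSize (L : ℝ) η lev₀ 3 𝔸),
      ∃ hpos : ∀ x : BondL2K ℂ d (fineP L m) c₀ W, x ≠ 0 →
          0 < RCLike.re (inner ℂ x (laplaceAofBackground L m hL φ U hα1 hU1 hreg τ η (c₀ := c₀) (c₁ := c₁) a x)),
      let Hc := H1LatticeCLM (lev₀ := lev₀) (levB := levB) φ hpos (QtorusW_surjective L m hL U hα1 hU1 hreg hαL φ) lev₁ (nabla115 η U)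
      let Gc := frakGLatticeCLM (lev₀ := lev₀) φ hpos (QtorusW_surjective L m hL U hα1 hU1 hreg hαL φ) lev₁ (nabla115 η U)
      let Cx := Cc L m η U lev₀ lev₁ (nabla115 η U) levB
      ‖Hc‖ ≤ CH ∧ ‖Gc‖ ≤ CG ∧
      Regime Hc 0 Cx CH 0 (2097152 * ((d : ℝ) + 1) ^ 2) (1 / (512 * ((d : ℝ) + 1))) 0 aC εC ∧
      ((∀ Y : Space115 (L : ℝ) η lev₀ lev₁ (nabla115 η U), ‖Y‖ < a₃ → ‖W80 ρ τc U Hc Cx εC J Δπ Y‖ ≤ C₄ * ‖Y‖ ^ 2) →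
        ‖Gc.comp (LJ ρ τc Hc Cx J)‖ ≤ θ →
        DifferentiableOn ℂ (chartHB Gc (-(Gc.comp (LJ ρ τc Hc Cx J))) (W80 ρ τc U Hc Cx εC J Δπ) 0
            (fun A' => A' + solA Hc 0 Cx 0 εC A') ε₄ Hc) (ball (0 : NegSize (L : ℝ) η levB 0 𝔸) Rb) ∧
        MapsTo (chartHB Gc (-(Gc.comp (LJ ρ τc Hc Cx J))) (W80 ρ τc U Hc Cx εC J Δπ) 0
            (fun A' => A' + solA Hc 0 Cx 0 εC A') ε₄ Hc) (ball (0 : NegSize (L : ℝ) η levB 0 𝔸) Rb)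
            (ball (0 : Space115 (L : ℝ) η lev₀ lev₁ (nabla115 η U)) R') ∧
        chartHB Gc (-(Gc.comp (LJ ρ τc Hc Cx J))) (W80 ρ τc U Hc Cx εC J Δπ) 0
            (fun A' => A' + solA Hc 0 Cx 0 εC A') ε₄ Hc 0 = 0) := by
  -- Thm 3.11 at every small field (owner gen 80) and the uniform operator letters (owner gen 81)
  obtain ⟨ε₃, hε₃, Hpos⟩ := laplaceAofBackground_pos_of_small_field L m hL φ (c₀ := c₀) (c₁ := c₁) (ne_of_gt (Fact.out : 0 < η)) ha hMφ
    hMφ' hφ hφ' τ hτ hCτ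
  obtain ⟨CH, CG, ε₅, hCH, hCG, hε₅, Hb⟩ :=
    exists_H1_frakG_CLM_bound_of_small_field L m hL φ (c₀ := c₀) (c₁ := c₁) (η := η) lev₀ levB lev₁ ha hMφ hMφ' hφ hφ' τ hτ hCτ
  -- the T-slot radius `r_C(C_H, d)` of NE9 leaf-01 (closed form; `a_C = ε_C = r_C`)
  obtain ⟨rC, hrC⟩ : ∃ r : ℝ, r = min (1 / (512 * ((d : ℝ) + 1)) / 4)
      (min ((1 : ℝ) / 2) (1 / (16 * (CH * (2097152 * ((d : ℝ) + 1) ^ 2) + 1)))) := ⟨_, rfl⟩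
  have hrC0 : 0 < rC := by
    have h := radius_pos (a₃ := 1 / (512 * ((d : ℝ) + 1))) (C₄ := 2097152 * ((d : ℝ) + 1) ^ 2) (δ := 1) hCH.le (by positivity)
      (by positivity) one_pos
    rw [hrC]; simpa using h
  have hcontrC : 4 * CH * (2097152 * ((d : ℝ) + 1) ^ 2) * (rC + rC) < 1 := by
    have h := radius_contr (a₃ := 1 / (512 * ((d : ℝ) + 1))) (C₄ := 2097152 * ((d : ℝ) + 1) ^ 2) (δ := 1) hCH.le (by positivity)
      (by positivity) one_pos
    rw [hrC]; simpa using h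
  have hdomC : 2 * (rC + rC) ≤ 1 / (512 * ((d : ℝ) + 1)) := by
    have h : rC ≤ 1 / (512 * ((d : ℝ) + 1)) / 4 := by rw [hrC]; exact min_le_left _ _
    linarith
  refine ⟨min ε₃ ε₅, CH, CG, rC, rC, lt_min hε₃ hε₅, hCH, hCG, hrC0, hrC0, hcontrC, hdomC, ?_⟩
  intro C₄ a₃ θ hC₄ ha₃ ha₃C hθ0 hθ1
  -- the Λ-slot radii of (D′) at `(C_G, θ̄, C₄, a₃, δ := r_C)` (closed form)
  obtain ⟨ε₄, hε₄def⟩ : ∃ e : ℝ, e = min (a₃ / 4) (min (rC / 2) ((1 - θ) / (16 * (CG * C₄ + 1)))) := ⟨_, rfl⟩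
  obtain ⟨a', ha'def⟩ : ∃ e : ℝ, e = (1 - θ) * ε₄ / (4 * (θ + 1)) := ⟨_, rfl⟩
  have hs : 0 < 1 - θ := by linarith
  have hε₄ : 0 < ε₄ := by rw [hε₄def]; exact min3_pos hCG.le hC₄ ha₃ hθ1 hrC0
  have ha' : 0 < a' := by rw [ha'def]; positivity
  have hcap : ε₄ + a' ≤ rC := by
    have h := radiiLinear_add_le hCG.le hC₄ ha₃ hθ0 hθ1 hrC0
    rw [ha'def, hε₄def]; exact h
  have hden : 0 < 1 - 4 * CH * (2097152 * ((d : ℝ) + 1) ^ 2) * (rC + rC) := by linarith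
  refine ⟨ε₄, a' / (CH + 1), 1 / (1 - 4 * CH * (2097152 * ((d : ℝ) + 1) ^ 2) * (rC + rC)) * (ε₄ + a'), hε₄, by positivity,
    by positivity, ?_⟩
  intro U α hα hα1 hU1 hreg hαL ε hε hεm hUε hRS ρ τc J Δπ
  have hpos := Hpos U hα1 hU1 hreg hε (hεm.trans (min_le_left _ _)) hUε hRS
  refine ⟨hpos, ?_⟩
  intro Hc Gc Cx
  obtain ⟨hH, hG⟩ := Hb U hα1 hU1 hreg hε (hεm.trans (min_le_right _ _)) hUε hRS hpos (QtorusW_surjective L m hL U hα1 hU1 hreg hαL φ)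
  -- the Sect. C regime at the uniform bound `C_H` (leaf-01's closed form, read at `r_C`)
  have RC : Regime Hc 0 Cx CH 0 (2097152 * ((d : ℝ) + 1) ^ 2) (1 / (512 * ((d : ℝ) + 1))) 0 rC rC := by
    rw [hrC]; exact sectC_regime_uniform_opNorm L m η lev₀ lev₁ levB hL hα hlev hCH.le U hU1 hreg Hc hH
  refine ⟨hH, hG, RC, fun hW4 hθ => ?_⟩
  -- the letter `C(U)`: U-free constants, analytic on its ball (NE9 leaf-03)
  have hC : Prop4Hyp Cx (2097152 * ((d : ℝ) + 1) ^ 2) (1 / (512 * ((d : ℝ) + 1))) :=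
    prop4Hyp_Cc L m η U lev₀ lev₁ (nabla115 η U) levB hL hα hU1 hreg hlev
  have hCa : AnalyticOnNhd ℂ Cx {Y | ‖Y‖ < 1 / (512 * ((d : ℝ) + 1))} :=
    analyticOnNhd_Cc L m η U lev₀ lev₁ (nabla115 η U) levB hL hα hU1 hreg hlev
  -- the W-slot: `W80` is analytic on `‖Y‖ < a₃ ≤ a_C`; only its (98) VALUE bound is displayed
  have hWa : AnalyticOnNhd ℂ (W80 ρ τc U Hc Cx rC J Δπ) {Y : Space115 (L : ℝ) η lev₀ lev₁ (nabla115 η U) | ‖Y‖ < a₃} :=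
    analyticOnNhd_W80_lt ρ τc U RC hC J Δπ ha₃C
  have hWq : QuadAnalytic (W80 ρ τc U Hc Cx rC J Δπ) C₄ a₃ := by
    refine ⟨hW4, fun P Q => ?_⟩
    have hline : Differentiable ℂ (fun ζ : ℂ => P + ζ • Q) := (differentiable_const P).add (differentiable_id.smul_const Q)
    exact hWa.differentiableOn.comp hline.differentiableOn fun ζ hζ => hζ
  -- the linear slot: `Λ := −(𝔊(U) ∘L L_J)` is `θ̄`-contractive, `𝔊(U)` is `C_G`-bounded
  have hGpt : ∀ f : NegSize (L : ℝ) η lev₀ 3 𝔸, ‖Gc f‖ ≤ CG * ‖f‖ :=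
    fun f => (ContinuousLinearMap.le_opNorm _ f).trans (mul_le_mul_of_nonneg_right hG (norm_nonneg f))
  have hΛ : ∀ Y : Space115 (L : ℝ) η lev₀ lev₁ (nabla115 η U), ‖(-(Gc.comp (LJ ρ τc Hc Cx J))) Y‖ ≤ θ * ‖Y‖ := fun Y => by
    rw [_root_.neg_apply, norm_neg]
    exact (ContinuousLinearMap.le_opNorm _ Y).trans (mul_le_mul_of_nonneg_right hθ (norm_nonneg Y))
  have R : Regime Gc (-(Gc.comp (LJ ρ τc Hc Cx J))) (W80 ρ τc U Hc Cx rC J Δπ) CG θ C₄ a₃ 0 a' ε₄ := by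
    have hj : (0 : ℝ) ≤ (1 - θ) * min (a₃ / 4) (min (rC / 2) ((1 - θ) / (16 * (CG * C₄ + 1)))) / (4 * (CG + 1)) := by
      have := min3_pos hCG.le hC₄ ha₃ hθ1 hrC0
      positivity
    have h := regime_linear_explicit hCG.le hC₄ ha₃ hθ0 hθ1 hrC0 Gc (-(Gc.comp (LJ ρ τc Hc Cx J))) hGpt hΛ hWq hj
    rw [ha'def, hε₄def]; exact h
  -- the datum ball: `‖H(U) B‖ < a` on `‖B‖ < a∕(C_H + 1)`
  have hRb : ∀ B ∈ ball (0 : NegSize (L : ℝ) η levB 0 𝔸) (a' / (CH + 1)), ‖Hc B‖ < a' := by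
    intro B hB
    rw [mem_ball_zero_iff] at hB
    have h1 : ‖Hc B‖ ≤ CH * ‖B‖ := (ContinuousLinearMap.le_opNorm _ B).trans (mul_le_mul_of_nonneg_right hH (norm_nonneg B))
    have h2 : CH * ‖B‖ ≤ CH * (a' / (CH + 1)) := mul_le_mul_of_nonneg_left hB.le hCH.le
    have h3 : CH * (a' / (CH + 1)) < a' := by
      rw [mul_div_assoc', div_lt_iff₀ (by positivity)]; nlinarith
    linarith
  exact chartHB_triple_of_twoRegimes R hWa le_rfl ha' RC hCa hcap Hc hRb (by positivity) le_rfl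

/-! ## §2 The W-slot letter PRODUCED uniformly: one pair of balls, only `θ̄` displayed -/

set_option maxRecDepth 8192 in
/-- **THE ONE-INSTANCE CHART OF `cur U` ON ONE PAIR OF BALLS FOR THE WHOLE SMALL-FIELD FAMILY, THE W-SLOT's (98)-CONSTANT PRODUCED** (§1 with
its `C₄` display DISCHARGED by `B11Ineq73KernelLettersUniform.exists_quadAnalytic_W80_uniform`): given the fibre∕trace letters, `0 < a`, the (L3)
letters `ρ`, `τc` (fixed operators), the V₀-slot letters `C_V ≥ 0`, `R_V > 0`, bounds `M_J, M_Δ ≥ 0` for the currents and a contraction `0 ≤ θ̄ < 1`,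
there are `ε₃ > 0`, T-slot radii `a_C, ε_C > 0`, a W-slot radius `a₃ > 0` with a constant `C₄ ≥ 0`, and chart radii `ε₄, R_b, R′ > 0` — ALL CHOSEN
BEFORE `∀ U` — such that for EVERY background `U` of E162's data with `‖U(b) − 1‖ ≤ ε ≤ ε₃` and `hRS`, the V₀-group's slot at `(C_V, R_V)`, and all
currents `J`, `Δπ` with `‖J‖ ≤ M_J`, `‖Δπ‖ ≤ M_Δ`: `hpos(U)` HOLDS and — at `H(U)`, `𝔊(U)`, `C(U)` as in §1 — `‖H(U)‖ ≤ C_H`, `‖𝔊(U)‖ ≤ C_G`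
(the uniform letters of (K), exposed for consumers), the Sect. C `Regime` at `(H(U), C(U), C_H, a_C, ε_C)`, the W-slot obeys (98) with the
uniform `(C₄, a₃)` (`QuadAnalytic (W80 ρ τc U H(U) C(U) ε_C J Δπ) C₄ a₃`, PRODUCED: `M_D = 2|η|⁻¹` by (N) `norm_nabla115_le`, `b = C_H` by (K), leaf-03's
U-free `C(U)` constants, `M_ρ = ‖ρ‖`, `M_τ = ‖τc‖`) and, WHENEVER `‖𝔊(U) ∘L L_J‖ ≤ θ̄`, (Ψ1)–(Ψ3) for the one-instance chart on `ball 0 R_b → ball 0 R′`.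
Only the linear slot's contraction `θ̄` remains displayed (its uniform discharge to «‖J‖ ≤ j̄₁» needs a uniform bound on `‖dQuad C(U)‖` — not in the
tree).  Per LATTICE (every number depends on `L, m`); NOT print's lattice-uniformity. [folklore] -/
theorem cur_chart_exists_oneInstance_smallField_uniform_W80 {d : ℕ} (L : ℕ) [NeZero L] (m : Fin d → ℕ) [∀ i, NeZero (fineP L m i)]
    (hL : 1 ≤ L)
    {𝔸 : Type*} [NormedRing 𝔸] [NormedAlgebra ℂ 𝔸] [CompleteSpace 𝔸] [NormOneClass 𝔸] [StarRing 𝔸] [NormedStarGroup 𝔸] [StarModule ℂ 𝔸]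
    [FiniteDimensional ℂ 𝔸]
    {W : Type*} [NormedAddCommGroup W] [InnerProductSpace ℂ W] [FiniteDimensional ℂ W] (φ : W ≃ₗ[ℂ] 𝔸) {Mφ Mφ' : ℝ} (hMφ : 0 ≤ Mφ)
    (hMφ' : 0 ≤ Mφ') (hφ : ∀ w, ‖φ w‖ ≤ Mφ * ‖w‖) (hφ' : ∀ X, ‖φ.symm X‖ ≤ Mφ' * ‖X‖)
    (τ : 𝔸 →ₗ[ℂ] ℂ) {Cτ : ℝ} (hτ : ∀ X, ‖τ X‖ ≤ Cτ * ‖X‖) (hCτ : 0 ≤ Cτ)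
    {η : ℝ} [Fact (0 < (L : ℝ))] [Fact (0 < η)] {lev₀ : Bond d (fineP L m) → ℕ} {levB : Bond d m → ℕ} (lev₁ : Bond d (fineP L m) × Fin d → ℕ)
    (hlev : ∀ b, 1 ≤ lev₀ b) {c₀ c₁ : ℝ} [Fact (0 < c₀)] [Fact (0 < c₁)] {a : ℝ} (ha : 0 < a)
    -- the (L3) letters, the V₀-slot letters, the current bounds and the linear slot's contraction — ALL BEFORE `∀ U`
    (ρ : (𝔸 →L[ℂ] ℂ) →L[ℂ] 𝔸) (τc : 𝔸 →L[ℂ] ℂ) {CV RV MJ MΔ θ : ℝ} (hCV : 0 ≤ CV) (hRV : 0 < RV) (hMJ : 0 ≤ MJ) (hMΔ : 0 ≤ MΔ)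
    (hθ0 : 0 ≤ θ) (hθ1 : θ < 1) :
    ∃ ε₃ CH CG aC εC a₃ C₄ ε₄ Rb R' : ℝ, 0 < ε₃ ∧ 0 < CH ∧ 0 < CG ∧ 0 < aC ∧ 0 < εC ∧ 0 < a₃ ∧ 0 ≤ C₄ ∧ 0 < ε₄ ∧ 0 < Rb ∧ 0 < R' ∧
      ∀ (U : Bond d (fineP L m) → 𝔸ˣ) {α : ℝ} (hα : α ≤ 1 / 128) (hα1 : α ≤ 1 / 64)
        (hU1 : ∀ (x : B7Prop1Explicit.Site d) (κ : Fin d), perCfg (fineP L m) U x κ ∈ U1 𝔸)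
        (hreg : ∀ (y : TSite d m) (κ : Fin d) (r : Fin d → Fin L),
          ‖((Wcx L (perCfg (fineP L m) U) (cornerSite L y) κ (boxVec L r) : 𝔸ˣ) : 𝔸) - 1‖ ≤ α)
        (hαL : 50 * (d + 1) * α * (L : ℝ) ^ d ≤ 1 / 2) {ε : ℝ}, 0 ≤ ε → ε ≤ ε₃ → (∀ b, ‖(U b : 𝔸) - 1‖ ≤ ε) →
        (∀ (b : Bond d (fineP L m)) (v u : W), inner ℂ (adTransportW φ U b v) u = inner ℂ v (adTransportW φ (fun b => (U b)⁻¹) b u)) →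
        (∀ Y : Space115 (L : ℝ) η lev₀ lev₁ (nabla115 η U), ‖Y‖ < RV →
          ‖curV0 (lev₁ := lev₁) (Dc := nabla115 η U) ρ τc U Y‖ ≤ CV * ‖Y‖ ^ 2) →
      ∀ (J : NegSize (L : ℝ) η lev₀ 3 𝔸) (Δπ : Space115 (L : ℝ) η lev₀ lev₁ (nabla115 η U) →L[ℂ] NegSize (L : ℝ) η lev₀ 3 𝔸),
        ‖J‖ ≤ MJ → ‖Δπ‖ ≤ MΔ →
      ∃ hpos : ∀ x : BondL2K ℂ d (fineP L m) c₀ W, x ≠ 0 →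
          0 < RCLike.re (inner ℂ x (laplaceAofBackground L m hL φ U hα1 hU1 hreg τ η (c₀ := c₀) (c₁ := c₁) a x)),
      let Hc := H1LatticeCLM (lev₀ := lev₀) (levB := levB) φ hpos (QtorusW_surjective L m hL U hα1 hU1 hreg hαL φ) lev₁ (nabla115 η U)
      let Gc := frakGLatticeCLM (lev₀ := lev₀) φ hpos (QtorusW_surjective L m hL U hα1 hU1 hreg hαL φ) lev₁ (nabla115 η U)
      let Cx := Cc L m η U lev₀ lev₁ (nabla115 η U) levB
      ‖Hc‖ ≤ CH ∧ ‖Gc‖ ≤ CG ∧ Regime Hc 0 Cx CH 0 (2097152 * ((d : ℝ) + 1) ^ 2) (1 / (512 * ((d : ℝ) + 1))) 0 aC εC ∧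
      QuadAnalytic (W80 ρ τc U Hc Cx εC J Δπ) C₄ a₃ ∧
      (‖Gc.comp (LJ ρ τc Hc Cx J)‖ ≤ θ →
        DifferentiableOn ℂ (chartHB Gc (-(Gc.comp (LJ ρ τc Hc Cx J))) (W80 ρ τc U Hc Cx εC J Δπ) 0
            (fun A' => A' + solA Hc 0 Cx 0 εC A') ε₄ Hc) (ball (0 : NegSize (L : ℝ) η levB 0 𝔸) Rb) ∧
        MapsTo (chartHB Gc (-(Gc.comp (LJ ρ τc Hc Cx J))) (W80 ρ τc U Hc Cx εC J Δπ) 0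
            (fun A' => A' + solA Hc 0 Cx 0 εC A') ε₄ Hc) (ball (0 : NegSize (L : ℝ) η levB 0 𝔸) Rb)
            (ball (0 : Space115 (L : ℝ) η lev₀ lev₁ (nabla115 η U)) R') ∧
        chartHB Gc (-(Gc.comp (LJ ρ τc Hc Cx J))) (W80 ρ τc U Hc Cx εC J Δπ) 0
            (fun A' => A' + solA Hc 0 Cx 0 εC A') ε₄ Hc 0 = 0) := by
  -- §1: the uniform operator letters, T-slot radii and (for any displayed `C₄ a₃ θ̄`) the chart radii
  obtain ⟨ε₃, CH, CG, aC, εC, hε₃, hCH, hCG, haC, hεC, hcontr, hdom, H1⟩ :=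
    cur_chart_exists_oneInstance_smallField_uniform L m hL φ hMφ hMφ' hφ hφ' τ hτ hCτ (η := η) (lev₀ := lev₀) (levB := levB) lev₁ hlev
      (c₀ := c₀) (c₁ := c₁) ha
  -- the W-slot letter from the bounds (`b := C_H`, `M_D := 2‖η⁻¹‖`, `M_ρ := ‖ρ‖`, `M_τ := ‖τc‖`)
  obtain ⟨a₃, ha₃, ha₃C, C₄, hC₄, HW⟩ :=
    exists_quadAnalytic_W80_uniform (𝔸 := 𝔸) (Pd := fineP L m) (L := (L : ℝ)) (η := η) (lev₀ := lev₀) (lev₁ := lev₁)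
      (𝒳 := NegSize (L : ℝ) η levB 0 𝔸) (C₂ := 2097152 * ((d : ℝ) + 1) ^ 2) (c₄ := 1 / (512 * ((d : ℝ) + 1)))
      (MD := 2 * ‖((η : ℂ))⁻¹‖) hCH.le (by positivity) haC hεC.le hdom hcontr hCV hRV (norm_nonneg ρ) (norm_nonneg τc) hMJ hMΔ
      (by positivity)
  obtain ⟨ε₄, Rb, R', hε₄, hRb, hR', H2⟩ := H1 hC₄ ha₃ ha₃C hθ0 hθ1
  refine ⟨ε₃, CH, CG, aC, εC, a₃, C₄, ε₄, Rb, R', hε₃, hCH, hCG, haC, hεC, ha₃, hC₄, hε₄, hRb, hR', ?_⟩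
  intro U α hα hα1 hU1 hreg hαL ε hε hεε₃ hUε hRS hqV J Δπ hJ hΔ
  obtain ⟨hpos, hmain⟩ := H2 U hα hα1 hU1 hreg hαL hε hεε₃ hUε hRS ρ τc J Δπ
  refine ⟨hpos, ?_⟩
  intro Hc Gc Cx
  obtain ⟨hH, hG, RC, himp⟩ := hmain
  -- `‖∇_U‖ ≤ 2|η|⁻¹` from the unit-boundedness read off `hU1`
  have hUb : ∀ b : Bond d (fineP L m), ‖(U b : 𝔸)‖ ≤ 1 ∧ ‖(((U b)⁻¹ : 𝔸ˣ) : 𝔸)‖ ≤ 1 := fun b => by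
    obtain ⟨y, κ⟩ := b
    have h := hU1 (liftSite y) κ
    rw [B9Eq315QTorus.perCfg_apply, perSite_liftSite] at h
    exact B7Prop1Explicit.mem_U1.1 h
  have hD : ∀ g : Bond d (fineP L m) → 𝔸, ‖nabla115 η U g‖ ≤ 2 * ‖((η : ℂ))⁻¹‖ * ‖g‖ := fun g => norm_nabla115_le η U hUb g
  have hC : Prop4Hyp Cx (2097152 * ((d : ℝ) + 1) ^ 2) (1 / (512 * ((d : ℝ) + 1))) :=
    prop4Hyp_Cc L m η U lev₀ lev₁ (nabla115 η U) levB hL hα hU1 hreg hlev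
  have hW := HW hD RC hC ρ τc U le_rfl le_rfl hqV J Δπ hJ hΔ
  exact ⟨hH, hG, RC, hW.1, fun hθ => himp hW.1.quad hθ⟩

/-! ## §3 The linear slot's contraction PRODUCED too: «‖J‖ ≤ j₁» uniform — no uniform letter displayed -/

set_option maxRecDepth 8192 in
/-- **THE ONE-INSTANCE CHART OF `cur U` ON ONE PAIR OF BALLS FOR THE WHOLE SMALL-FIELD FAMILY AND ALL SMALL CURRENTS — NOTHING UNIFORM DISPLAYED**
(§2 with its last display `θ̄` DISCHARGED by `B11Eq79LinearTermUniform.exists_norm_LJ_le_uniform`: `‖L_J‖ ≤ K‖J‖` with `K` U-free, Cauchy's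
inequality for `D²C(U)(0)` + the column constant through `M_D = 2|η|⁻¹`): given the fibre∕trace letters, `0 < a`, the fixed (L3) operators `ρ`, `τc`,
the V₀-slot letters `C_V ≥ 0`, `R_V > 0` and current bounds `M_J > 0`, `M_Δ ≥ 0`, there are `ε₃ > 0`, T-slot radii `a_C, ε_C > 0`, W-slot letters
`a₃ > 0`, `C₄ ≥ 0`, chart radii `ε₄, R_b, R′ > 0` and a current threshold `0 < j₁ ≤ M_J` — ALL BEFORE `∀ U` — such that for EVERY background `U` of
E162's data with `‖U(b) − 1‖ ≤ ε ≤ ε₃`, `hRS`, the V₀-group's slot at `(C_V, R_V)`, and ALL currents with `‖J‖₍₋₃₎ ≤ j₁`, `‖Δπ‖ ≤ M_Δ`: `hpos(U)` HOLDS,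
the W-slot obeys (98) at `(C₄, a₃)`, the linear slot is `½`-contractive (`‖𝔊(U) ∘L L_J‖ ≤ ½`), and lit-balaban's one-instance chart
`chartHB 𝔊(U) (−(𝔊(U) ∘L L_J)) (W80 ρ τc U H(U) C(U) ε_C J Δπ) 0 (A′ ↦ A′ + solA H(U) 0 C(U) 0 ε_C A′) ε₄ H(U)` satisfies (Ψ1)–(Ψ3) on
`ball 0 R_b → ball 0 R′`.  Displayed: E162's data, `ε ≤ ε₃`, `hRS`, the V₀-slot at FIXED `(C_V, R_V)`, `‖J‖ ≤ j₁`, `‖Δπ‖ ≤ M_Δ` — T23's species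
with (d2)'s positivity, its small-J threshold AND (d3)'s radii uniform in `U` at a fixed lattice (print's (28) «|J| < C₁B₃ε₁» read with ONE `ε₁`
for the family).  Per LATTICE throughout. [folklore] -/
theorem cur_chart_exists_oneInstance_smallField_uniform_smallJ {d : ℕ} (L : ℕ) [NeZero L] (m : Fin d → ℕ) [∀ i, NeZero (fineP L m i)]
    (hL : 1 ≤ L)
    {𝔸 : Type*} [NormedRing 𝔸] [NormedAlgebra ℂ 𝔸] [CompleteSpace 𝔸] [NormOneClass 𝔸] [StarRing 𝔸] [NormedStarGroup 𝔸] [StarModule ℂ 𝔸]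
    [FiniteDimensional ℂ 𝔸]
    {W : Type*} [NormedAddCommGroup W] [InnerProductSpace ℂ W] [FiniteDimensional ℂ W] (φ : W ≃ₗ[ℂ] 𝔸) {Mφ Mφ' : ℝ} (hMφ : 0 ≤ Mφ)
    (hMφ' : 0 ≤ Mφ') (hφ : ∀ w, ‖φ w‖ ≤ Mφ * ‖w‖) (hφ' : ∀ X, ‖φ.symm X‖ ≤ Mφ' * ‖X‖)
    (τ : 𝔸 →ₗ[ℂ] ℂ) {Cτ : ℝ} (hτ : ∀ X, ‖τ X‖ ≤ Cτ * ‖X‖) (hCτ : 0 ≤ Cτ)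
    {η : ℝ} [Fact (0 < (L : ℝ))] [Fact (0 < η)] {lev₀ : Bond d (fineP L m) → ℕ} {levB : Bond d m → ℕ} (lev₁ : Bond d (fineP L m) × Fin d → ℕ)
    (hlev : ∀ b, 1 ≤ lev₀ b) {c₀ c₁ : ℝ} [Fact (0 < c₀)] [Fact (0 < c₁)] {a : ℝ} (ha : 0 < a)
    (ρ : (𝔸 →L[ℂ] ℂ) →L[ℂ] 𝔸) (τc : 𝔸 →L[ℂ] ℂ) {CV RV MJ MΔ : ℝ} (hCV : 0 ≤ CV) (hRV : 0 < RV) (hMJ : 0 < MJ) (hMΔ : 0 ≤ MΔ) :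
    ∃ ε₃ aC εC a₃ C₄ ε₄ Rb R' j₁ : ℝ, 0 < ε₃ ∧ 0 < aC ∧ 0 < εC ∧ 0 < a₃ ∧ 0 ≤ C₄ ∧ 0 < ε₄ ∧ 0 < Rb ∧ 0 < R' ∧ 0 < j₁ ∧ j₁ ≤ MJ ∧
      ∀ (U : Bond d (fineP L m) → 𝔸ˣ) {α : ℝ} (hα : α ≤ 1 / 128) (hα1 : α ≤ 1 / 64)
        (hU1 : ∀ (x : B7Prop1Explicit.Site d) (κ : Fin d), perCfg (fineP L m) U x κ ∈ U1 𝔸)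
        (hreg : ∀ (y : TSite d m) (κ : Fin d) (r : Fin d → Fin L),
          ‖((Wcx L (perCfg (fineP L m) U) (cornerSite L y) κ (boxVec L r) : 𝔸ˣ) : 𝔸) - 1‖ ≤ α)
        (hαL : 50 * (d + 1) * α * (L : ℝ) ^ d ≤ 1 / 2) {ε : ℝ}, 0 ≤ ε → ε ≤ ε₃ → (∀ b, ‖(U b : 𝔸) - 1‖ ≤ ε) →
        (∀ (b : Bond d (fineP L m)) (v u : W), inner ℂ (adTransportW φ U b v) u = inner ℂ v (adTransportW φ (fun b => (U b)⁻¹) b u)) →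
        (∀ Y : Space115 (L : ℝ) η lev₀ lev₁ (nabla115 η U), ‖Y‖ < RV →
          ‖curV0 (lev₁ := lev₁) (Dc := nabla115 η U) ρ τc U Y‖ ≤ CV * ‖Y‖ ^ 2) →
      ∀ (J : NegSize (L : ℝ) η lev₀ 3 𝔸) (Δπ : Space115 (L : ℝ) η lev₀ lev₁ (nabla115 η U) →L[ℂ] NegSize (L : ℝ) η lev₀ 3 𝔸),
        ‖J‖ ≤ j₁ → ‖Δπ‖ ≤ MΔ →
      ∃ hpos : ∀ x : BondL2K ℂ d (fineP L m) c₀ W, x ≠ 0 →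
          0 < RCLike.re (inner ℂ x (laplaceAofBackground L m hL φ U hα1 hU1 hreg τ η (c₀ := c₀) (c₁ := c₁) a x)),
      let Hc := H1LatticeCLM (lev₀ := lev₀) (levB := levB) φ hpos (QtorusW_surjective L m hL U hα1 hU1 hreg hαL φ) lev₁ (nabla115 η U)
      let Gc := frakGLatticeCLM (lev₀ := lev₀) φ hpos (QtorusW_surjective L m hL U hα1 hU1 hreg hαL φ) lev₁ (nabla115 η U)
      let Cx := Cc L m η U lev₀ lev₁ (nabla115 η U) levB
      QuadAnalytic (W80 ρ τc U Hc Cx εC J Δπ) C₄ a₃ ∧ ‖Gc.comp (LJ ρ τc Hc Cx J)‖ ≤ 1 / 2 ∧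
      DifferentiableOn ℂ (chartHB Gc (-(Gc.comp (LJ ρ τc Hc Cx J))) (W80 ρ τc U Hc Cx εC J Δπ) 0
          (fun A' => A' + solA Hc 0 Cx 0 εC A') ε₄ Hc) (ball (0 : NegSize (L : ℝ) η levB 0 𝔸) Rb) ∧
      MapsTo (chartHB Gc (-(Gc.comp (LJ ρ τc Hc Cx J))) (W80 ρ τc U Hc Cx εC J Δπ) 0
          (fun A' => A' + solA Hc 0 Cx 0 εC A') ε₄ Hc) (ball (0 : NegSize (L : ℝ) η levB 0 𝔸) Rb)
          (ball (0 : Space115 (L : ℝ) η lev₀ lev₁ (nabla115 η U)) R') ∧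
      chartHB Gc (-(Gc.comp (LJ ρ τc Hc Cx J))) (W80 ρ τc U Hc Cx εC J Δπ) 0
          (fun A' => A' + solA Hc 0 Cx 0 εC A') ε₄ Hc 0 = 0 := by
  -- §2 at the contraction `θ̄ := 1/2`
  obtain ⟨ε₃, CH, CG, aC, εC, a₃, C₄, ε₄, Rb, R', hε₃, hCH, hCG, haC, hεC, ha₃, hC₄, hε₄, hRb, hR', H2⟩ :=
    cur_chart_exists_oneInstance_smallField_uniform_W80 L m hL φ hMφ hMφ' hφ hφ' τ hτ hCτ (η := η) (lev₀ := lev₀) (levB := levB) lev₁ hlev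
      (c₀ := c₀) (c₁ := c₁) ha ρ τc hCV hRV hMJ.le hMΔ (θ := 1 / 2) (by norm_num) (by norm_num)
  -- the linear slot's uniform constant (`b := C_H`, `M_D := 2‖η⁻¹‖`, `M_ρ := ‖ρ‖`, `M_τ := ‖τc‖`)
  obtain ⟨K, hK0, HK⟩ :=
    exists_norm_LJ_le_uniform (𝔸 := 𝔸) (Pd := fineP L m) (L := (L : ℝ)) (η := η) (lev₀ := lev₀) (lev₁ := lev₁)
      (𝒳 := NegSize (L : ℝ) η levB 0 𝔸) (b := CH) (C₂ := 2097152 * ((d : ℝ) + 1) ^ 2) (c₄ := 1 / (512 * ((d : ℝ) + 1))) (aC := aC)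
      (εC := εC) (MD := 2 * ‖((η : ℂ))⁻¹‖) hCH.le (by positivity) haC (norm_nonneg ρ) (norm_nonneg τc) (by positivity)
  have hden : 0 < 2 * (CG * K + 1) := by positivity
  refine ⟨ε₃, aC, εC, a₃, C₄, ε₄, Rb, R', min MJ (1 / (2 * (CG * K + 1))), hε₃, haC, hεC, ha₃, hC₄, hε₄, hRb, hR',
    lt_min hMJ (by positivity), min_le_left _ _, ?_⟩
  intro U α hα hα1 hU1 hreg hαL ε hε hεε₃ hUε hRS hqV J Δπ hJ hΔ
  obtain ⟨hpos, hmain⟩ := H2 U hα hα1 hU1 hreg hαL hε hεε₃ hUε hRS hqV J Δπ (hJ.trans (min_le_left _ _)) hΔ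
  refine ⟨hpos, ?_⟩
  intro Hc Gc Cx
  obtain ⟨-, hG, RC, hWq, himp⟩ := hmain
  -- `‖∇_U‖ ≤ 2|η|⁻¹`, the Sect. C regime at `C_H` and leaf-03's `Prop4Hyp` (as in §2) feed the `L_J` bound
  have hUb : ∀ b : Bond d (fineP L m), ‖(U b : 𝔸)‖ ≤ 1 ∧ ‖(((U b)⁻¹ : 𝔸ˣ) : 𝔸)‖ ≤ 1 := fun b => by
    obtain ⟨y, κ⟩ := b
    have h := hU1 (liftSite y) κ
    rw [B9Eq315QTorus.perCfg_apply, perSite_liftSite] at h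
    exact B7Prop1Explicit.mem_U1.1 h
  have hD : ∀ g : Bond d (fineP L m) → 𝔸, ‖nabla115 η U g‖ ≤ 2 * ‖((η : ℂ))⁻¹‖ * ‖g‖ := fun g => norm_nabla115_le η U hUb g
  have hC : Prop4Hyp Cx (2097152 * ((d : ℝ) + 1) ^ 2) (1 / (512 * ((d : ℝ) + 1))) :=
    prop4Hyp_Cc L m η U lev₀ lev₁ (nabla115 η U) levB hL hα hU1 hreg hlev
  have hLJ : ‖LJ ρ τc Hc Cx J‖ ≤ K * ‖J‖ := HK hD RC hC ρ τc le_rfl le_rfl J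
  have hθ : ‖Gc.comp (LJ ρ τc Hc Cx J)‖ ≤ 1 / 2 := by
    have hfrac : CG * K / (2 * (CG * K + 1)) ≤ 1 / 2 := by
      rw [div_le_div_iff₀ hden (by norm_num : (0 : ℝ) < 2)]
      nlinarith [mul_nonneg hCG.le hK0]
    calc ‖Gc.comp (LJ ρ τc Hc Cx J)‖ ≤ ‖Gc‖ * ‖LJ ρ τc Hc Cx J‖ := ContinuousLinearMap.opNorm_comp_le _ _
      _ ≤ CG * (K * ‖J‖) := mul_le_mul hG hLJ (ContinuousLinearMap.opNorm_nonneg _) hCG.le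
      _ ≤ CG * (K * (1 / (2 * (CG * K + 1)))) := by
          have hJ' : ‖J‖ ≤ 1 / (2 * (CG * K + 1)) := hJ.trans (min_le_right _ _)
          exact mul_le_mul_of_nonneg_left (mul_le_mul_of_nonneg_left hJ' hK0) hCG.le
      _ = CG * K / (2 * (CG * K + 1)) := by ring
      _ ≤ 1 / 2 := hfrac
  exact ⟨hWq, hθ, himp hθ⟩

end Summit.QuantumFields.BalabanUV.T4Continuum.NE9CurChartOneInstanceUniformBall

end
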